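import Summits.BirchSwinnertonDyer.Rank1Residual.Additive.KummerSelmerRestriction
import Summits.BirchSwinnertonDyer.Rank1Residual.Additive.LayerNoPTorsion
import Summits.BirchSwinnertonDyer.Rank1Residual.Additive.ZpTowerSeam
import Summits.BirchSwinnertonDyer.Rank1Residual.X11b.LocalTrivialityBridge
import HarnessLib

/-!
# Injectivity of `Sel⁽ⁿ⁾(E/K) → Sel⁽ⁿ⁾(E_L/L)` when `E[n](K̄)^{Γ_L} = 0`; the layers of a
# `ℤ_p`-extension (row T-E3g-JOINT, FILE J-C1b; seat p10 GEN 5)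

HONEST FRAMING (cell `b2b-bsdres`, run/shared/lean/b2b/bsd-rank1-residual/, verbatim in every
file): the goal of the cell is to DELETE the COMBINATION-SHAPED residual classes of the
Birch–Swinnerton-Dyer formula for ALL analytic-rank `≤ 1` elliptic curves over `ℚ` — "full BSD
formula for every rank `≤ 1` curve in class `C`" assembled STRICTLY from published theorems — so
that the rank-`≤ 1` remainder becomes exactly the CONSTRUCTION-SHAPED classes, which are TYPED
(missing-input `Prop`s), NOT attempted. This is not "finishing BSD". Team n1011 (N10/N11, the
Route-G LOWER budget node): research route; TOOL theorems; nothing is booked by this file; no mark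
/ label moved. THEOREMS ONLY: no definition, no named fact, no `sorry`.

## What

* `resBaseChangeTorsion_injective_of_forall_smul_eq` — if the image `galRange L` of `Γ_L → Γ_K` is
  normal and no non-zero `n`-torsion point of `E(K̄)` is fixed by it, the restriction
  `H¹(K, E[n]) → H¹(L, E_L[n])` (`resBaseChangeTorsion`, FILE J-C1) is injective (inflation–
  restriction by hand: a class dying on the normal subgroup `N` is represented by a cocycle
  vanishing on `N`, whose values are `N`-fixed);
* `resBaseChangeTorsion_layer_injective` — for the layer `K_n = κ.layer n` of a `ℤ_p`-extension and
  `E(K)[p] = 0`: injective (`galRange K_n = κ⁻¹(pⁿℤ_p)` is normal, n1011-p01's seam; a `p`-torsion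
  point fixed by it is fixed by `ker κ`, hence zero, `fixedPoints_kerSubgroup_geomPrimaryTorsion_eq_bot`).

References: J.-P. Serre, *Galois Cohomology* I.§2.6 (inflation–restriction); R. Greenberg, LNM
1716 (1999) §1 p. 62, §4 p. 109 [GreenbergLNM1716].
-/

noncomputable section

open scoped Classical
open Field Function Literature.NumberTheory.EllipticCurves Literature.NumberTheory.GaloisRepresentations
open Summit.BirchSwinnertonDyer.Rank1Residual

universe u

namespace WeierstrassCurve

/-! ### §1 Injectivity from `E[n](K̄)^{Γ_L} = 0` -/

section Injective

variable {K : Type u} [Field K] [CharZero K] (W : WeierstrassCurve K) [W.IsElliptic]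
  (L : Type u) [Field L] [Algebra K L] {n : ℤ} (hn : n ≠ 0)

/-- **`H¹(K, E[n]) → H¹(L, E_L[n])` is injective when `galRange L ⊴ Γ_K` fixes no non-zero
`n`-torsion point.** (A class in the kernel is `[φ]` with `φ` principal on `N = galRange L`,
`φ = ∂x` there; `ψ = φ − ∂x` vanishes on `N`, so `ψ(g) = ψ(g n) = (g n g⁻¹) • ψ(g)` for `n ∈ N`:
`ψ(g)` is `N`-fixed, hence `0`, and `φ = ∂x`.) [folklore] -/
theorem resBaseChangeTorsion_injective_of_forall_smul_eq
    (hN : (galRange (K := K) L).Normal)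
    (hfix : ∀ T : geomTorsion W n, (∀ τ ∈ galRange (K := K) L, τ • T = T) → T = 0) :
    Injective (resBaseChangeTorsion W L hn) := by
  refine (injective_iff_map_eq_zero _).mpr fun c hc ↦ ?_
  obtain ⟨φ, rfl⟩ :=
    oneCocycleClass_surjective (discreteTopRep (absoluteGaloisGroup K) (geomTorsion W n)) c
  -- `φ` is principal on `galRange L`: `φ (res l) = res l • x - x`
  obtain ⟨x, hx⟩ := (X11b.LocBridge.resH1Hom_oneCocycleClass_eq_zero_iff (resGal (K := K) L)
    ((W.torsionTransferEquiv (E := L) hn : geomTorsion W n ≃+ geomTorsion (W.baseChange L) n) :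
      geomTorsion W n →+ geomTorsion (W.baseChange L) n)
    (fun σ T ↦ W.torsionTransferEquiv_smul (E := L) hn σ T)
    (W.torsionTransferEquiv (E := L) hn).bijective φ).mp hc
  have hmul : ∀ g h : absoluteGaloisGroup K, φ.1 (g * h) = φ.1 g + g • φ.1 h := fun g h ↦ by
    rw [φ.2 g h, discreteTopRep_ρ_apply]
  have hφN : ∀ τ ∈ galRange (K := K) L, φ.1 τ = τ • x - x := by
    rintro τ ⟨l, rfl⟩
    exact hx l
  -- `ψ = φ − ∂x` takes `N`-fixed values: `τ • ψ(g) = ψ(g)` for `τ ∈ N`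
  have hψfix : ∀ (g : absoluteGaloisGroup K), ∀ τ ∈ galRange (K := K) L,
      τ • (φ.1 g - (g • x - x)) = φ.1 g - (g • x - x) := by
    intro g τ hτ
    have hm : g⁻¹ * τ * g ∈ galRange (K := K) L := by
      have h := hN.conj_mem τ hτ g⁻¹
      rwa [inv_inv] at h
    -- `φ (τ g)` two ways
    have h1 : φ.1 (τ * g) = τ • x - x + τ • φ.1 g := by rw [hmul, hφN τ hτ]
    have h2 : φ.1 (τ * g) = φ.1 g + (τ • g • x - g • x) := by
      rw [show τ * g = g * (g⁻¹ * τ * g) by group, hmul, hφN _ hm, smul_sub, ← mul_smul,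
        show g * (g⁻¹ * τ * g) = τ * g by group, mul_smul]
    have key : τ • φ.1 g = φ.1 g + (τ • g • x - g • x) - (τ • x - x) := by
      rw [← h2, h1]; abel
    rw [smul_sub, smul_sub, key]
    abel
  -- hence `ψ = 0`, i.e. `φ = ∂x`
  have hzero : ∀ g : absoluteGaloisGroup K, φ.1 g = g • x - x := fun g ↦ by
    have h := hfix _ (hψfix g)
    rwa [sub_eq_zero] at h
  exact (oneCocycleClass_eq_zero_iff _ _).mpr ⟨x, fun g ↦ by rw [discreteTopRep_ρ_apply]; exact hzero g⟩

end Injective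

/-! ### §2 The layers of a `ℤ_p`-extension -/

section Layer

open Summit.BirchSwinnertonDyer.Rank1Residual.Additive

variable {K : Type} [Field K] [NumberField K] (W : WeierstrassCurve K) [W.IsElliptic] {p : ℕ}
  [hp : Fact p.Prime] (κ : ZpExtension K p) (n : ℕ)

/-- **`H¹(K, E[p]) → H¹(K_n, E_{K_n}[p])` is injective when `E(K)[p] = 0`**, for every layer
`K_n = κ.layer n` of a `ℤ_p`-extension: the image of `Γ_{K_n}` is `κ⁻¹(pⁿℤ_p)` (n1011-p01's seam
`galRange_layer_eq_layerSubgroup`), normal; a `p`-torsion point of `E(K̄)` fixed by it is fixed by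
`ker κ`, hence `0` (`fixedPoints_kerSubgroup_geomPrimaryTorsion_eq_bot`).
[cite: GreenbergLNM1716, §1 p. 62 and §4 p. 109] -/
theorem resBaseChangeTorsion_layer_injective (hK : ∀ P : W.toAffine.Point, p • P = 0 → P = 0) :
    Injective (resBaseChangeTorsion W (κ.layer n) (n := (p : ℤ))
      (by exact_mod_cast hp.out.ne_zero)) := by
  refine resBaseChangeTorsion_injective_of_forall_smul_eq W (κ.layer n) _ ?_ fun T hT ↦ ?_
  · rw [ZpTower.galRange_layer_eq_layerSubgroup κ n]
    infer_instance
  · have hprim : (T : geomPoints W) ∈ geomPrimaryTorsion W p :=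
      (AddCommGroup.mem_primaryComponent).mpr ⟨1, by
        rw [pow_one, ← natCast_zsmul]
        exact T.2⟩
    have hmem : (⟨(T : geomPoints W), hprim⟩ : geomPrimaryTorsion W p) ∈
        FixedPoints.addSubgroup κ.kerSubgroup (geomPrimaryTorsion W p) := by
      rw [FixedPoints.mem_addSubgroup]
      rintro ⟨τ, hτ⟩
      apply Subtype.ext
      change τ • (T : geomPoints W) = (T : geomPoints W)
      have hτ' : τ ∈ galRange (K := K) (κ.layer n) := by
        rw [ZpTower.galRange_layer_eq_layerSubgroup κ n]
        exact κ.kerSubgroup_le_layerSubgroup n hτ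
      have h := congrArg Subtype.val (hT τ hτ')
      exact h
    rw [W.fixedPoints_kerSubgroup_geomPrimaryTorsion_eq_bot κ hK] at hmem
    have h0 : (T : geomPoints W) = 0 :=
      congrArg Subtype.val ((AddSubgroup.mem_bot (G := geomPrimaryTorsion W p)).mp hmem)
    exact Subtype.ext h0

end Layer

end WeierstrassCurve

end
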